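import Summits.BirchSwinnertonDyer.BirchSwinnertonDyer.Theorems.ErratumRoadFiveNonSurjCornerG9Group
import Literature.NumberTheory.EllipticCurves.SerreOpenImageNormalizerCaseProofs
import HarnessLib

/-!
# Route `ErratumRoadFive` (rung K2), crux `NonSurjCorner` (item stmt-BirchSwinnertonDyer-19065), line `Lines/hybrid.lean`, r22 slot 6″, step (L1),
# input (T) for the OCTAHEDRAL corner image: the determinant-one part of Zywina's `G₉` (`5S4`) is trace-orthogonal to no element of `G₉`
# (cell `bsd-stepL`, seat `bsd-stepL-corner-p1` g18; `--supports stmt-BirchSwinnertonDyer-19065 --as helper`)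

WHY THIS FILE. Companion of `…AuxPrimeTracePropertyCartan` (split-Cartan-normaliser images): the trace property (T) consumed by
`AuxPrimeSupplyCorner.exists_preWitness_of_rangeK` for the other corner image at `5`, a conjugate `P G₉ P⁻¹` of Zywina's `G₉` (lane B's
`CornerShape.NonSurjCorner.image_five_eq_normalizer_or_eq_G9`). Trick: (T) for `g` follows from ONE element `s` of the image with `det s = det ρ̄(g)` and
`tr s ≠ 0` (take `σ₀` with `ρ̄(σ₀) = ρ̄(g)⁻¹ s`); in `G₉` the four determinant fibres contain `1` (tr 2), `gA = diag(2,1)` (det 2, tr 3), `gA³ = diag(3,1)`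
(det 3, tr 4), `gD² = 2·1` (det 4, tr 4).
* `AuxPrimeSupplyCorner.traceProperty_of_image_eq_map_G9`.

HONEST FRAMING: ONE THEOREM (no definition, no named fact, no `sorry`); finite group theory on Zywina's generators (lane B's `ZywinaG9.exists_generators`);
nothing about any curve's BSD; 19065 NOT closed; BSD is not advanced; T7.
References (locators only): [cite: Zywina2015, §1.3, Thm. 1.4] [cite: Serre1972, §2.6] [cite: GrossLMS1991, §3 (p. 239)].
-/

noncomputable section

set_option autoImplicit false
set_option linter.dupNamespace false -- `Summit.BirchSwinnertonDyer.BirchSwinnertonDyer` (summit = problem), tree-wide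

open scoped Classical MatrixGroups
open WeierstrassCurve Field Matrix
open Literature.NumberTheory.GaloisRepresentations Literature.NumberTheory.EllipticCurves
open Literature.NumberTheory.EllipticCurves.Zywina2015G9

namespace Summit.BirchSwinnertonDyer.BirchSwinnertonDyer.Theorems.AuxPrimeSupplyCorner

/-! ### Numeric facts in `ZMod 5` and `M₂(ZMod 5)` (stated instance-free so that `decide` evaluates) -/

/-- The five elements of `ZMod 5`. [folklore] -/
theorem zmod_five_cases : ∀ d : ZMod 5, d = 0 ∨ d = 1 ∨ d = 2 ∨ d = 3 ∨ d = 4 := by decide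

/-- `tr 1 = 2 ≠ 0` in `ZMod 5`. [folklore] -/
theorem zmod_five_two_ne_zero : (2 : ZMod 5) ≠ 0 := by decide

/-- `3 ≠ 0` in `ZMod 5`. [folklore] -/
theorem zmod_five_three_ne_zero : (3 : ZMod 5) ≠ 0 := by decide

/-- `4 ≠ 0` in `ZMod 5`. [folklore] -/
theorem zmod_five_four_ne_zero : (4 : ZMod 5) ≠ 0 := by decide

/-- `diag(2,1)³ = diag(3,1)` over `ZMod 5`. [folklore] -/
theorem diag_two_one_pow_three : (!![(2 : ZMod 5), 0; 0, 1] : Matrix (Fin 2) (Fin 2) (ZMod 5)) ^ 3 = !![3, 0; 0, 1] := by decide +kernel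

/-- `(1 1; 1 4)² = 2·1` over `ZMod 5`. [folklore] -/
theorem gD_sq : (!![(1 : ZMod 5), 1; 1, 4] : Matrix (Fin 2) (Fin 2) (ZMod 5)) ^ 2 = !![2, 0; 0, 2] := by decide +kernel

/-- **(T) for an octahedral (`G₉`, `5S4`) image.** If `Φ(ρ̄_{E,5}(Γ_ℚ)) = P G₉ P⁻¹`, then for every `g ∈ Γ_ℚ` some `σ₀ ∈ Γ_ℚ` with `det Φ(ρ̄ σ₀) = 1`
has `tr Φ(ρ̄(g σ₀)) ≠ 0`. [cite: Zywina2015, §1.3] -/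
theorem traceProperty_of_image_eq_map_G9 (W : WeierstrassCurve ℚ) [W.IsElliptic] [Fact (Nat.Prime 5)]
    (Φ : Multiplicative (AddAut (geomTorsion W ((5 : ℕ) : ℤ))) ≃* GL (Fin 2) (ZMod 5)) {P : GL (Fin 2) (ZMod 5)}
    (hG : (galoisRepTorsion W ((5 : ℕ) : ℤ)).range.map Φ.toMonoidHom = G9.map (MulAut.conj P).toMonoidHom) :
    ∀ g : absoluteGaloisGroup ℚ, ∃ σ₀ : absoluteGaloisGroup ℚ,
      Matrix.GeneralLinearGroup.det (Φ (galoisRepTorsion W ((5 : ℕ) : ℤ) σ₀)) = 1 ∧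
      Matrix.trace ((Φ (galoisRepTorsion W ((5 : ℕ) : ℤ) (g * σ₀)) : GL (Fin 2) (ZMod 5)) : Matrix (Fin 2) (Fin 2) (ZMod 5)) ≠ 0 := by
  intro g
  set ρ := galoisRepTorsion W ((5 : ℕ) : ℤ) with hρ
  set X : GL (Fin 2) (ZMod 5) := Φ (ρ g) with hX
  have hXG : X ∈ (ρ.range).map Φ.toMonoidHom := apply_galoisRepTorsion_mem_map_range W 5 Φ g
  clear_value X
  -- the reduction to one element `s` of the image with `det s = det X`, `tr s ≠ 0`
  have key : ∀ s : GL (Fin 2) (ZMod 5), s ∈ G9.map (MulAut.conj P).toMonoidHom →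
      Matrix.GeneralLinearGroup.det s = Matrix.GeneralLinearGroup.det X →
      Matrix.trace ((s : GL (Fin 2) (ZMod 5)) : Matrix (Fin 2) (Fin 2) (ZMod 5)) ≠ 0 →
      ∃ σ₀ : absoluteGaloisGroup ℚ, Matrix.GeneralLinearGroup.det (Φ (ρ σ₀)) = 1 ∧
        Matrix.trace ((Φ (ρ (g * σ₀)) : GL (Fin 2) (ZMod 5)) : Matrix (Fin 2) (Fin 2) (ZMod 5)) ≠ 0 := by
    intro s hs hdets htrs
    have hmem : X⁻¹ * s ∈ (ρ.range).map Φ.toMonoidHom := by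
      refine Subgroup.mul_mem _ (Subgroup.inv_mem _ hXG) ?_
      rw [hG]; exact hs
    obtain ⟨σ₀, hσ₀⟩ := (mem_map_range_galoisRepTorsion_iff W 5 Φ).mp hmem
    refine ⟨σ₀, ?_, ?_⟩
    · rw [hσ₀, map_mul, map_inv, hdets, inv_mul_cancel]
    · rw [map_mul, map_mul, hσ₀, ← hX, mul_inv_cancel_left]
      exact htrs
  -- conjugates of elements of `G₉` lie in the image; trace and determinant are conjugation invariant
  have hconj : ∀ m : GL (Fin 2) (ZMod 5), m ∈ G9 → P * m * P⁻¹ ∈ G9.map (MulAut.conj P).toMonoidHom :=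
    fun m hm ↦ ⟨m, hm, by rw [MulEquiv.coe_toMonoidHom, MulAut.conj_apply]⟩
  have htrconj : ∀ M : GL (Fin 2) (ZMod 5),
      Matrix.trace ((P * M * P⁻¹ : GL (Fin 2) (ZMod 5)) : Matrix (Fin 2) (Fin 2) (ZMod 5)) =
        Matrix.trace (M : Matrix (Fin 2) (Fin 2) (ZMod 5)) := fun M ↦ by
    rw [Units.val_mul, Units.val_mul, Matrix.trace_mul_cycle, ← Units.val_mul, inv_mul_cancel, Units.val_one, Matrix.one_mul]
  have hdetconj : ∀ M : GL (Fin 2) (ZMod 5),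
      Matrix.GeneralLinearGroup.det (P * M * P⁻¹) = Matrix.GeneralLinearGroup.det M := fun M ↦ by
    rw [map_mul, map_mul, map_inv, mul_inv_cancel_comm]
  -- Zywina's generators `gA = diag(2,1)`, `gD = (1 1; 1 4)`
  obtain ⟨gA, -, -, gD, ⟨hAm, -, -, hDm⟩, hA, -, -, hD⟩ := ZywinaG9.exists_generators
  have hA' : (gA : Matrix (Fin 2) (Fin 2) (ZMod 5)) = !![2, 0; 0, 1] := by
    simp only [Quad.ofMatrix, Prod.mk.injEq] at hA
    obtain ⟨h00, h01, h10, h11⟩ := hA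
    ext i j; fin_cases i <;> fin_cases j <;> simp [h00, h01, h10, h11]
  have hD' : (gD : Matrix (Fin 2) (Fin 2) (ZMod 5)) = !![1, 1; 1, 4] := by
    simp only [Quad.ofMatrix, Prod.mk.injEq] at hD
    obtain ⟨h00, h01, h10, h11⟩ := hD
    ext i j; fin_cases i <;> fin_cases j <;> simp [h00, h01, h10, h11]
  have hdetval : ∀ M : GL (Fin 2) (ZMod 5),
      ((Matrix.GeneralLinearGroup.det M : (ZMod 5)ˣ) : ZMod 5) = (M : Matrix (Fin 2) (Fin 2) (ZMod 5)).det :=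
    fun M ↦ Matrix.GeneralLinearGroup.val_det_apply M
  -- the determinant of `X` is one of `1, 2, 3, 4`
  have hdX0 : ((Matrix.GeneralLinearGroup.det X : (ZMod 5)ˣ) : ZMod 5) ≠ 0 := (Matrix.GeneralLinearGroup.det X).ne_zero
  rcases zmod_five_cases ((Matrix.GeneralLinearGroup.det X : (ZMod 5)ˣ) : ZMod 5) with h0 | h1 | h2 | h3 | h4
  · exact absurd h0 hdX0
  · -- `s = 1`
    refine key 1 (Subgroup.one_mem _) ?_ ?_
    · ext; rw [map_one, Units.val_one, h1]
    · rw [Units.val_one, Matrix.trace_one, Fintype.card_fin]; exact_mod_cast zmod_five_two_ne_zero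
  · -- `s = P gA P⁻¹`
    refine key (P * gA * P⁻¹) (hconj gA hAm) ?_ ?_
    · ext; rw [hdetconj, hdetval, hA', Matrix.det_fin_two_of, h2]; ring
    · rw [htrconj, hA', Matrix.trace_fin_two_of]; norm_num; exact zmod_five_three_ne_zero
  · -- `s = P gA³ P⁻¹`
    refine key (P * gA ^ 3 * P⁻¹) (hconj _ (G9.pow_mem hAm 3)) ?_ ?_
    · ext; rw [hdetconj, map_pow, Units.val_pow_eq_pow_val, hdetval, hA', Matrix.det_fin_two_of, h3]; reduce_mod_char
    · rw [htrconj, Units.val_pow_eq_pow_val, hA', diag_two_one_pow_three, Matrix.trace_fin_two_of]; norm_num; exact zmod_five_four_ne_zero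
  · -- `s = P gD² P⁻¹ = 2·1`
    refine key (P * gD ^ 2 * P⁻¹) (hconj _ (G9.pow_mem hDm 2)) ?_ ?_
    · ext; rw [hdetconj, map_pow, Units.val_pow_eq_pow_val, hdetval, hD', Matrix.det_fin_two_of, h4]; reduce_mod_char
    · rw [htrconj, Units.val_pow_eq_pow_val, hD', gD_sq, Matrix.trace_fin_two_of]; norm_num; exact zmod_five_four_ne_zero

end Summit.BirchSwinnertonDyer.BirchSwinnertonDyer.Theorems.AuxPrimeSupplyCorner

end
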